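import Mathlib.RingTheory.MvPolynomial.Basic
import Mathlib.RingTheory.Localization.Away.Basic
import Mathlib.RingTheory.Ideal.Quotient.Operations
import HarnessLib

/-!
# The chart map of the root cover exists (crux `FInjectiveMacaulayfication`, line `Sketch`)

Support file for crux stmt-ResolutionOfSingularities-15315 (`FrobeniusLadder.FInjectiveMacaulayfication`,
line `Sketch`), cycle-9 WEIGHTED CONE ENGINE (§15 of the registered skeleton 10f06f91). The registered
stubs `stub_weightedChartInjective` (#20), `stub_weightedChartImage` (#21) take as a HYPOTHESIS a ring
map `Θ : (k[X]/(f))[x_v^{-c}] → (k[X]/(g))[x_v^{-1}]` compatible with the root-cover substitution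
`θ = θ_v` (`θ (X v) = X v ^ (w v)`, `θ (X j) = X j * X v ^ (w j)`) on `k[X]`; the engine assembly
(`stub_weightedChartClause` #22, `stub_weightedConeFiModel` #23) must produce it. This file does:

* `exists_chartMap` — if `θ f = X v ^ D * g` then there is a ring map
  `Θ : Localization.Away (mk_f (X v) ^ c) →+* Localization.Away (mk_g (X v))` with
  `Θ (algebraMap (mk_f s)) = algebraMap (mk_g (θ s))` for all `s : k[X]`.

Construction: `s ↦ [θ s]/1` kills `f` (`θ f = X v ^ D g ∈ (g)`), so it descends to `k[X]/(f)`
(`Ideal.Quotient.lift`); it sends `x_v ^ c` to `[X v] ^ (w v * c)`, a unit of `(k[X]/(g))[x_v^{-1}]`, so it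
extends to the localization (`IsLocalization.Away.lift`). [folklore]
-/

-- single-problem summit: the doubled namespace component is forced
set_option linter.dupNamespace false

namespace Summit.ResolutionOfSingularities.ResolutionOfSingularities.Theorems.FInjectiveMacaulayfication.WeightedChartMap

open MvPolynomial

/-- **The chart map exists.** For the substitution `θ (X v) = X v ^ (w v)`, `θ (X j) = X j * X v ^ (w j)`
and `θ f = X v ^ D * g`, there is a ring map `Θ : (k[X]/(f))[x_v^{-c}] → (k[X]/(g))[x_v^{-1}]` with
`Θ ([s]/1) = [θ s]/1` for every polynomial `s`. [folklore] -/
theorem exists_chartMap (k : Type) [Field k] (n : ℕ) (w : Fin n → ℕ) (v : Fin n) (c D : ℕ)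
    (f g : MvPolynomial (Fin n) k)
    (hfg : MvPolynomial.aeval (fun j : Fin n => if j = v then (MvPolynomial.X v : MvPolynomial (Fin n) k) ^ (w v)
      else MvPolynomial.X j * MvPolynomial.X v ^ (w j)) f = MvPolynomial.X v ^ D * g) :
    ∃ Θ : Localization.Away (Ideal.Quotient.mk (Ideal.span {f}) (MvPolynomial.X v) ^ c) →+*
      Localization.Away (Ideal.Quotient.mk (Ideal.span {g}) (MvPolynomial.X v)),
    ∀ s : MvPolynomial (Fin n) k,
      Θ (algebraMap (MvPolynomial (Fin n) k ⧸ Ideal.span {f})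
        (Localization.Away (Ideal.Quotient.mk (Ideal.span {f}) (MvPolynomial.X v) ^ c))
        (Ideal.Quotient.mk (Ideal.span {f}) s)) =
      algebraMap (MvPolynomial (Fin n) k ⧸ Ideal.span {g})
        (Localization.Away (Ideal.Quotient.mk (Ideal.span {g}) (MvPolynomial.X v)))
        (Ideal.Quotient.mk (Ideal.span {g}) (MvPolynomial.aeval (fun j : Fin n => if j = v then
          (MvPolynomial.X v : MvPolynomial (Fin n) k) ^ (w v) else MvPolynomial.X j * MvPolynomial.X v ^ (w j)) s)) := by
  set φ : MvPolynomial (Fin n) k →ₐ[k] MvPolynomial (Fin n) k := MvPolynomial.aeval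
    (fun j : Fin n => if j = v then (MvPolynomial.X v : MvPolynomial (Fin n) k) ^ (w v)
      else MvPolynomial.X j * MvPolynomial.X v ^ (w j)) with hφ
  set xf := Ideal.Quotient.mk (Ideal.span {f}) (MvPolynomial.X v) ^ c with hxf
  set xg := Ideal.Quotient.mk (Ideal.span {g}) (MvPolynomial.X v) with hxg
  -- `s ↦ [θ s]/1`
  set θ' : MvPolynomial (Fin n) k →+* Localization.Away xg :=
    (algebraMap (MvPolynomial (Fin n) k ⧸ Ideal.span {g}) (Localization.Away xg)).comp
      ((Ideal.Quotient.mk (Ideal.span {g})).comp φ.toRingHom) with hθ'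
  have hθ'apply : ∀ s, θ' s = algebraMap (MvPolynomial (Fin n) k ⧸ Ideal.span {g}) (Localization.Away xg)
      (Ideal.Quotient.mk (Ideal.span {g}) (φ s)) := fun s => rfl
  -- it kills `f`
  have hker : ∀ a ∈ Ideal.span {f}, θ' a = 0 := by
    intro a ha
    obtain ⟨b, rfl⟩ := Ideal.mem_span_singleton'.1 ha
    rw [hθ'apply, map_mul, hfg, map_mul, map_mul, map_mul,
      Ideal.Quotient.eq_zero_iff_mem.2 (Ideal.mem_span_singleton_self g), mul_zero, map_zero, mul_zero]
  set θ'' : MvPolynomial (Fin n) k ⧸ Ideal.span {f} →+* Localization.Away xg :=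
    Ideal.Quotient.lift (Ideal.span {f}) θ' hker with hθ''
  -- `x_v ^ c ↦ [X v] ^ (w v * c)`, a unit
  have hunit : IsUnit (θ'' xf) := by
    rw [hxf, map_pow, hθ'', Ideal.Quotient.lift_mk, hθ'apply, hφ, aeval_X, if_pos rfl, map_pow, map_pow,
      ← pow_mul]
    exact (IsLocalization.Away.algebraMap_isUnit (S := Localization.Away xg) xg).pow _
  refine ⟨IsLocalization.Away.lift xf hunit, fun s => ?_⟩
  rw [IsLocalization.Away.lift_eq, hθ'', Ideal.Quotient.lift_mk, hθ'apply]

end Summit.ResolutionOfSingularities.ResolutionOfSingularities.Theorems.FInjectiveMacaulayfication.WeightedChartMap
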